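import Literature.NumberTheory.LFunctions.GaussianHeckeLogDerivPackage
import HarnessLib

/-!
# The three local inputs of the de la Vallée-Poussin–Landau argument for `L(s, λ^m)` over `ℚ(i)`

Topic `Literature/NumberTheory/LFunctions`.  Everything in this file is PROVED; no definitions, no named facts.
For the continued Dirichlet series `D_m = 4 L(·, λ^m)` of the angular characters `λ^m(z) = (z/|z|)^{4m}` of `ℤ[i]`
(`GaussianHecke.heckeL`) and their prime-power series `P_m = −D_m'/D_m` (`GaussianHecke.heckeP`), we prove the
three elementary inequalities that, together with a Richert-type upper bound near `σ = 1`, yield a zero-free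
region by Titchmarsh's Theorem 3.10 (`GaussianHeckeColemanZFR.lean`):

* `re_heckeP_comb_nonneg` — the **`3-4-1` inequality in logarithmic-derivative form**:
  `Re(3 P_0(σ) + 4 P_m(σ + it) + P_{2m}(σ + 2it)) ≥ 0` for `σ > 1` (termwise: the `n`-th term is
  `n^{-σ} ∑_{N(π)^j = n} log N(π) · (3 + 4w + w²)`, `w = λ^m(π)^j n^{-it}`, `|w| = 1`; Hecke 1920 §7 /
  Montgomery–Vaughan Lemma 6.5 for `ζ_K`-twists);
* `exists_re_heckeP_zero_le` — the **polar bound** `Re P_0(1 + d) ≤ 1/d + K₀` (`0 < d ≤ 1`), from the tree's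
  `exists_norm_heckeP_le`;
* `exists_norm_heckeL_ge` — the **lower bound right of the line**: `‖D_m(1 + d + it)‖ ≥ κ d` for `0 < d ≤ 1`, all `m`
  and `t`, with an absolute `κ > 0` (from `1 ≤ ‖D_0(1+d)³ D_m(1+d+it)⁴ D_{2m}(1+d+2it)‖` and
  `∑_z N(z)^{-1-d} = Re D_0(1+d) ≤ sup_{[1,2]}|H|/d`, `H(s) = (s−1)D_0(s)`).

## References

* E. Hecke, Math. Z. 6 (1920), 11–51, §7. [cite: HeckeMathZ1920, §7]
* H. L. Montgomery, R. C. Vaughan, *Multiplicative Number Theory I*, Lemma 6.5 and §11.1. [cite: MontgomeryVaughan2007, Lemma 6.5]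
* E. C. Titchmarsh, *The Theory of the Riemann Zeta-Function*, 2nd ed., Theorem 3.10. [cite: Titchmarsh1986, Theorem 3.10]
-/

noncomputable section

open Complex Filter Topology Finset LSeries Set

namespace Literature.NumberTheory.LFunctions

namespace GaussianHecke

open GaussianInt GaussianTheta

/-! ### The `3-4-1` inequality for `P_m = -D_m'/D_m` -/

/-- The `n`-th term of `3 P_0(σ) + 4 P_m(σ+it) + P_{2m}(σ+2it)` has nonnegative real part (`σ` real): with
`u = n^{-it}` and `w = λ^m(π)^j u` it equals `n^{-σ} ∑_{(π,j)} log N(π) (3 + 4w + w²)`. [cite: HeckeMathZ1920, §7] -/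
theorem re_term_lcomb_nonneg (m : ℕ) (σ t : ℝ) (n : ℕ) :
    0 ≤ (3 * term (lCoeff 0) σ n + 4 * term (lCoeff m) (σ + t * I) n +
      term (lCoeff (2 * m)) (σ + 2 * t * I) n).re := by
  rcases eq_or_ne n 0 with rfl | hn
  · simp
  have hn0 : (n : ℂ) ≠ 0 := Nat.cast_ne_zero.mpr hn
  set u : ℂ := (n : ℂ) ^ (-(t * I)) with hu
  have hnu : ‖u‖ = 1 := by
    rw [hu, Complex.norm_natCast_cpow_of_pos (Nat.pos_of_ne_zero hn)]; simp
  set r : ℝ := (n : ℝ) ^ σ with hr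
  have hr0 : 0 < r := Real.rpow_pos_of_pos (Nat.cast_pos.mpr (Nat.pos_of_ne_zero hn)) σ
  have hnσ : (n : ℂ) ^ (σ : ℂ) = (r : ℂ) := by
    rw [hr, Complex.ofReal_cpow (Nat.cast_nonneg n)]
    norm_cast
  have hrc : (r : ℂ) ≠ 0 := ofReal_ne_zero.mpr hr0.ne'
  have h1 : term (lCoeff 0) σ n = (r : ℂ)⁻¹ * lCoeff 0 n := by
    rw [term_of_ne_zero hn, hnσ, div_eq_inv_mul]
  have h2 : term (lCoeff m) (σ + t * I) n = (r : ℂ)⁻¹ * (lCoeff m n * u) := by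
    rw [term_of_ne_zero hn, cpow_add _ _ hn0, hnσ, hu, cpow_neg]
    field_simp
  have h3 : term (lCoeff (2 * m)) (σ + 2 * t * I) n = (r : ℂ)⁻¹ * (lCoeff (2 * m) n * u ^ 2) := by
    have hu2 : u ^ 2 = ((n : ℂ) ^ (2 * t * I))⁻¹ := by
      rw [hu, ← cpow_nat_mul, ← cpow_neg]
      congr 1
      push_cast
      ring
    rw [term_of_ne_zero hn, cpow_add _ _ hn0, hnσ, hu2]
    field_simp
  rw [h1, h2, h3, show (3 : ℂ) * ((r : ℂ)⁻¹ * lCoeff 0 n) + 4 * ((r : ℂ)⁻¹ * (lCoeff m n * u)) +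
      (r : ℂ)⁻¹ * (lCoeff (2 * m) n * u ^ 2) =
      (r : ℂ)⁻¹ * (3 * lCoeff 0 n + 4 * (lCoeff m n * u) + lCoeff (2 * m) n * u ^ 2) by ring,
    ← Complex.ofReal_inv, re_ofReal_mul]
  refine mul_nonneg (inv_nonneg.mpr hr0.le) ?_
  -- expand the three coefficient sums over `pairsNorm n`
  have hexp : 3 * lCoeff 0 n + 4 * (lCoeff m n * u) + lCoeff (2 * m) n * u ^ 2 =
      ∑ p ∈ pairsNorm n, ((Real.log (p.1.norm : ℝ) : ℝ) : ℂ) *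
        (3 + 4 * (angularChar m p.1 ^ p.2 * u) + (angularChar m p.1 ^ p.2 * u) ^ 2) := by
    simp only [lCoeff, mul_sum, sum_mul, ← sum_add_distrib]
    refine sum_congr rfl fun p _ ↦ ?_
    rw [angularChar_zero_left, one_pow, angularChar_two_mul, ← pow_mul, mul_comm 2 p.2, pow_mul]
    ring
  rw [hexp, re_sum]
  refine sum_nonneg fun p hp ↦ ?_
  obtain ⟨hπ, -, -⟩ := mem_pairsNorm.mp hp
  have hprime : Prime p.1 := (mem_primesQ1.mp hπ).1
  have hπ0 : p.1 ≠ 0 := hprime.ne_zero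
  have hlog0 : 0 ≤ Real.log (p.1.norm : ℝ) := by
    refine Real.log_nonneg ?_
    have := two_le_norm_of_prime hprime
    exact_mod_cast (by omega : (1 : ℤ) ≤ p.1.norm)
  rw [re_ofReal_mul]
  refine mul_nonneg hlog0 (re_three_add_nonneg ?_)
  rw [norm_mul, norm_pow, norm_angularChar hπ0, one_pow, one_mul, hnu]

/-- **`Re (3 P_0(σ) + 4 P_m(σ+it) + P_{2m}(σ+2it)) ≥ 0`** for `σ > 1`: the `3-4-1` inequality for the
logarithmic derivatives of the Hecke `L`-functions of `ℚ(i)`. [cite: HeckeMathZ1920, §7]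
[cite: MontgomeryVaughan2007, Lemma 6.5] -/
theorem re_heckeP_comb_nonneg (m : ℕ) {σ : ℝ} (hσ : 1 < σ) (t : ℝ) :
    0 ≤ (3 * heckeP 0 σ + 4 * heckeP m (σ + t * I) + heckeP (2 * m) (σ + 2 * t * I)).re := by
  have hs1 : 1 < (σ : ℂ).re := by rwa [ofReal_re]
  have hs2 : 1 < ((σ : ℂ) + t * I).re := by
    rwa [add_re, ofReal_re, mul_re, ofReal_re, ofReal_im, I_re, I_im, mul_zero, zero_mul,
      sub_zero, add_zero]
  have hs3 : 1 < ((σ : ℂ) + 2 * t * I).re := by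
    rw [show (2 : ℂ) * t * I = ((2 * t : ℝ) : ℂ) * I by push_cast; ring]
    rwa [add_re, ofReal_re, mul_re, ofReal_re, ofReal_im, I_re, I_im, mul_zero, zero_mul,
      sub_zero, add_zero]
  have hsum : HasSum (fun n ↦ 3 * term (lCoeff 0) σ n + 4 * term (lCoeff m) (σ + t * I) n +
      term (lCoeff (2 * m)) (σ + 2 * t * I) n)
      (3 * heckeP 0 σ + 4 * heckeP m (σ + t * I) + heckeP (2 * m) (σ + 2 * t * I)) :=
    (((LSeriesSummable_lCoeff 0 hs1).hasSum.mul_left 3).add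
      ((LSeriesSummable_lCoeff m hs2).hasSum.mul_left 4)).add (LSeriesSummable_lCoeff (2 * m) hs3).hasSum
  rw [← hsum.tsum_eq, Complex.re_tsum hsum.summable]
  exact tsum_nonneg fun n ↦ re_term_lcomb_nonneg m σ t n

/-! ### The polar bound for `P_0` -/

/-- **`Re P_0(1 + d) ≤ 1/d + K₀`** for `0 < d ≤ 1`, with the absolute `K₀` of `exists_norm_heckeP_le`.
[cite: MontgomeryVaughan2007, Lemma 6.4 (proof)] -/
theorem exists_re_heckeP_zero_le :
    ∃ K₀ : ℝ, 0 ≤ K₀ ∧ ∀ d : ℝ, 0 < d → d ≤ 1 → (heckeP 0 ((1 + d : ℝ) : ℂ)).re ≤ 1 / d + K₀ := by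
  obtain ⟨K₀, hK₀, hK⟩ := exists_norm_heckeP_le
  refine ⟨K₀, hK₀, fun d hd hd1 ↦ ?_⟩
  have h := hK 0 (((1 + d : ℝ)) : ℂ) (by simp; linarith) (by simp; linarith)
  rw [ofReal_re, show 1 + d - 1 = d by ring] at h
  exact (Complex.re_le_norm _).trans h

/-! ### `∑_z N(z)^{-σ} = Re D_0(σ)` and the lower bound for `‖D_m(1 + d + it)‖` -/

/-- `∑_z N(z)^{-σ} = Re D_0(σ)` for real `σ > 1`. [folklore] -/
theorem normSum_eq_re_heckeL_zero {σ : ℝ} (hσ : 1 < σ) :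
    ∑' x : GaussianInt, ((x.norm : ℤ) : ℝ) ^ (-σ) = (heckeL 0 (σ : ℂ)).re := by
  have h := hasSum_heckeL 0 (s := (σ : ℂ)) (by simpa using hσ)
  have h2 := h.mapL Complex.reCLM
  have h3 : HasSum (fun x : GaussianInt ↦ ((x.norm : ℤ) : ℝ) ^ (-σ)) (heckeL 0 (σ : ℂ)).re := by
    refine (h2.congr_fun fun x ↦ ?_)
    simp only [Complex.reCLM_apply]
    split_ifs with hx
    · subst hx
      rw [Complex.zero_re, Zsqrtd.norm_zero, Int.cast_zero, Real.zero_rpow (by linarith)]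
    · have hN : (0 : ℝ) < (x.norm : ℝ) := by exact_mod_cast GaussianInt.norm_pos.mpr hx
      rw [angularChar_zero_left, ← Complex.ofReal_cpow hN.le, ← Complex.ofReal_one, ← Complex.ofReal_div,
        Complex.ofReal_re, one_div, Real.rpow_neg hN.le]
  exact h3.tsum_eq

/-- **`H` is bounded on `[1, 2]`**: there is `K ≥ 1` with `‖H(σ)‖ ≤ K` for `1 ≤ σ ≤ 2` (continuity, compactness).
[folklore] -/
theorem exists_norm_heckeH_le : ∃ K : ℝ, 1 ≤ K ∧ ∀ σ : ℝ, 1 ≤ σ → σ ≤ 2 → ‖heckeH (σ : ℂ)‖ ≤ K := by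
  have hK : IsCompact (((↑) : ℝ → ℂ) '' Icc (1 : ℝ) 2) := isCompact_Icc.image continuous_ofReal
  have hcont : ContinuousOn heckeH (((↑) : ℝ → ℂ) '' Icc (1 : ℝ) 2) := by
    intro s hs
    obtain ⟨σ, hσ, rfl⟩ := hs
    have hs0 : (σ : ℂ) ≠ 0 := by
      intro h; have := congrArg Complex.re h; simp at this; linarith [hσ.1]
    exact (differentiableAt_heckeH hs0).continuousAt.continuousWithinAt
  obtain ⟨C, hC⟩ := hK.exists_bound_of_continuousOn hcont
  refine ⟨max C 1, le_max_right _ _, fun σ h1 h2 ↦ (hC σ ⟨σ, ⟨h1, h2⟩, rfl⟩).trans (le_max_left _ _)⟩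

/-- `∑_z N(z)^{-(1+d)} ≤ K/d` for `0 < d ≤ 1`, `K = sup_{[1,2]} |H|` (`D_0(1+d) = H(1+d)/d`). [folklore] -/
theorem exists_normSum_le :
    ∃ K : ℝ, 1 ≤ K ∧ ∀ d : ℝ, 0 < d → d ≤ 1 →
      ∑' x : GaussianInt, ((x.norm : ℤ) : ℝ) ^ (-(1 + d)) ≤ K / d := by
  obtain ⟨K, hK1, hK⟩ := exists_norm_heckeH_le
  refine ⟨K, hK1, fun d hd hd1 ↦ ?_⟩
  rw [normSum_eq_re_heckeL_zero (by linarith)]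
  have hs1 : ((1 + d : ℝ) : ℂ) ≠ 1 := by
    intro h; have := congrArg Complex.re h; simp at this; linarith
  have hH := heckeH_eq hs1
  have hsub : ((1 + d : ℝ) : ℂ) - 1 = (d : ℂ) := by push_cast; ring
  rw [hsub] at hH
  have hd0 : (d : ℂ) ≠ 0 := ofReal_ne_zero.mpr hd.ne'
  have hL : heckeL 0 ((1 + d : ℝ) : ℂ) = heckeH ((1 + d : ℝ) : ℂ) / d := by
    rw [hH, mul_div_cancel_left₀ _ hd0]
  calc (heckeL 0 ((1 + d : ℝ) : ℂ)).re ≤ ‖heckeL 0 ((1 + d : ℝ) : ℂ)‖ := Complex.re_le_norm _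
    _ = ‖heckeH ((1 + d : ℝ) : ℂ)‖ / d := by
        rw [hL, norm_div, Complex.norm_real, Real.norm_of_nonneg hd.le]
    _ ≤ K / d := div_le_div_of_nonneg_right (hK (1 + d) (by linarith) (by linarith)) hd.le

/-- **`‖D_m(1 + d + it)‖ ≥ κ d`** for all `m`, `0 < d ≤ 1` and real `t`, with an absolute `κ > 0`: from
`1 ≤ ‖D_0(1+d)³ D_m(1+d+it)⁴ D_{2m}(1+d+2it)‖ ≤ (B ‖D_m(1+d+it)‖)⁴`, `B = ∑_z N(z)^{-1-d} ≤ K/d`.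
[cite: HeckeMathZ1920, §7] -/
theorem exists_norm_heckeL_ge :
    ∃ κ : ℝ, 0 < κ ∧ ∀ (m : ℕ) (d : ℝ), 0 < d → d ≤ 1 → ∀ t : ℝ,
      κ * d ≤ ‖heckeL m (1 + d + t * I)‖ := by
  obtain ⟨K, hK1, hK⟩ := exists_normSum_le
  have hK0 : 0 < K := by linarith
  refine ⟨1 / K, by positivity, fun m d hd hd1 t ↦ ?_⟩
  set B : ℝ := ∑' x : GaussianInt, ((x.norm : ℤ) : ℝ) ^ (-(1 + d)) with hB
  have hBK : B ≤ K / d := hK d hd hd1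
  have hB1 : 1 ≤ B := one_le_normSum (by linarith)
  have hB0 : 0 < B := by linarith
  set L : ℝ := ‖heckeL m (1 + d + t * I)‖ with hL
  have hprod := one_le_norm_heckeL_product m (x := d) hd t
  have e1 : (1 : ℂ) + (d : ℂ) = (((1 + d : ℝ)) : ℂ) := by push_cast; ring
  have e2 : (1 : ℂ) + (d : ℂ) + I * t = 1 + d + t * I := by ring
  have e3 : (1 : ℂ) + (d : ℂ) + 2 * I * t = (((1 + d : ℝ)) : ℂ) + ((2 * t : ℝ) : ℂ) * I := by
    push_cast; ring
  rw [e2, e3, norm_mul, norm_mul, norm_pow, norm_pow, ← hL, e1] at hprod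
  have hb0 : ‖heckeL 0 (((1 + d : ℝ)) : ℂ)‖ ≤ B := by
    have hre : ((((1 + d : ℝ)) : ℂ)).re = 1 + d := ofReal_re _
    have := norm_heckeL_le_normSum 0 (s := (((1 + d : ℝ)) : ℂ)) (by rw [hre]; linarith)
    rwa [hre] at this
  have hb2 : ‖heckeL (2 * m) ((((1 + d : ℝ)) : ℂ) + ((2 * t : ℝ) : ℂ) * I)‖ ≤ B := by
    have hre : ((((1 + d : ℝ)) : ℂ) + ((2 * t : ℝ) : ℂ) * I).re = 1 + d := by simp
    have := norm_heckeL_le_normSum (2 * m) (s := (((1 + d : ℝ)) : ℂ) + ((2 * t : ℝ) : ℂ) * I)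
      (by rw [hre]; linarith)
    rwa [hre] at this
  have hL0 : 0 ≤ L := norm_nonneg _
  have h4 : 1 ≤ (B * L) ^ 4 := by
    calc (1 : ℝ) ≤ ‖heckeL 0 (((1 + d : ℝ)) : ℂ)‖ ^ 3 * L ^ 4 *
          ‖heckeL (2 * m) ((((1 + d : ℝ)) : ℂ) + ((2 * t : ℝ) : ℂ) * I)‖ := hprod
      _ ≤ B ^ 3 * L ^ 4 * B := by gcongr
      _ = (B * L) ^ 4 := by ring
  have hBL : 1 ≤ B * L := by
    by_contra h
    rw [not_le] at h
    have := pow_lt_one₀ (by positivity : 0 ≤ B * L) h (by norm_num : (4 : ℕ) ≠ 0)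
    linarith
  -- `L ≥ 1/B ≥ d/K`
  have hLB : 1 / B ≤ L := by
    rw [div_le_iff₀ hB0]; linarith [mul_comm B L]
  have hdK : 1 / K * d ≤ 1 / B := by
    rw [one_div_mul_eq_div, div_le_div_iff₀ hK0 hB0]
    have := (le_div_iff₀ hd).mp hBK
    linarith
  exact hdK.trans hLB

end GaussianHecke

end Literature.NumberTheory.LFunctions
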